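import Summits.BirchSwinnertonDyer.Rank1Residual.P2.CornerFTwoModelClasses
import Summits.BirchSwinnertonDyer.Rank1Residual.WAll.TargetCMTwoInertShuZhaiThirtySix
import Summits.BirchSwinnertonDyer.Rank1Residual.X12.CMIsogenyInvariance
import HarnessLib

/-!
# Leaf CornerF @ `p = 2` — THE MODEL ATLAS, file 4 (cell `bsd-print-cf2`, D-0131 (2) print tier,
# typer ty2): the residual of the p3 road `WAllCornerFTwoInertOffShuZhaiThirtySix` IN MODEL CURRENCY

HONEST FRAMING (cell `bsd-print-cf2`, HOME `run/shared/lean/pub/bsd-print-cf2/`, verbatim in every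
file): the partition leaf is `CornerF W 2` — `W/ℚ` globally minimal elliptic WITH CM and
`ord_{s=1} L(E,s) = 1`, at the prime `2` (rung leaf `WAllCornerFTwo`; OPEN AS A CLASS). The p3 road
(cube sums / `√−3`-descent / Shu–Zhai) closes the INERT type on the `ℚ`-isogeny classes of the
explicit Shu–Zhai twists `36a1^{(−p∏q)}` (`P2.IsIsogenousToShuZhaiThirtySixTwist`, p539515/p540044)
and names its residual `WAllCornerFTwoInertOffShuZhaiThirtySix`: CM, `r_an = 1`, `2` inert in `K`,
`W` NOT `ℚ`-isogenous to any such twist ⇒ `BSD(E,2)`. Files 1–2 of the atlas reduce the inert type to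
eight explicit model families; here the residual is rewritten through them. The family clause is an
ISOGENY condition, so it can be dropped exactly on the branches whose CM FIELD is not `ℚ(√−3)` (the CM
field is a `ℚ`-isogeny invariant: tree `X12.cmFieldDiscrOfJ_eq_of_isIsogenous`) — the five odd Heegner
fields `cm11`, `cm19`, `cm43`, `cm67`, `cm163` become five CLAUSE-FREE explicit twist families with
nothing in print at `2` —, and it is KEPT on the three `ℚ(√−3)` branches (`y² = x³ + B`; twists of
`⟨0,6,0,−3,0⟩ = curve36a1'`, `j = 54000`, which contain curves isogenous to `36a1`-twists (class
`36a` has `j ∈ {0, 54000}`); twists of `27a4`, `j = −12288000`). Fact-free: NO arithmetic fact, NO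
definition, NO named fact (D-0026).

## Contents

* `cmFieldDiscrOfJ_eq_neg_three_of_isIsogenousToShuZhaiThirtySixTwist`,
  `not_isIsogenousToShuZhaiThirtySixTwist_of_cmFieldDiscrOfJ_ne` (a CM curve with `d_K ≠ −3` is
  isogenous to no Shu–Zhai twist);
* `wAllCornerFTwoInertOffShuZhaiThirtySix_iff_models`: p3's residual ⟺ (1) sextics `y² = x³ + B` off
  the classes ∧ (2) `j = 54000` twists off the classes ∧ (3) `27a4` twists off the classes ∧ (4)–(8)
  ALL square-free twists of `cm11`, `cm19`, `cm43`, `cm67`, `cm163` of analytic rank one (no clause).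

References: [SilvermanAEC2009] III.6 Cor. 6.2 / III.9 (isogeny and endomorphism algebra), X.5 Prop.
5.4; [SilvermanATAEC1994] App. A §3; [ShuZhai2021] Thm. 1.2 / 1.4, §5.2 Table row `36a1`;
`WAll/TargetCMTwoInertShuZhaiThirtySix.lean` (p3), `X12/CMIsogenyInvariance.lean`,
`P2/CornerFTwoModelAtlas.lean`, `P2/CornerFTwoModelClasses.lean` (ty2).
-/

noncomputable section

open scoped Classical

open WeierstrassCurve Literature.NumberTheory.EllipticCurves
  Literature.NumberTheory.EllipticCurves.Rank1Residual

set_option autoImplicit false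

namespace Summit.BirchSwinnertonDyer.Rank1Residual.P2.CornerFTwo

open Atlas

section OffShuZhai

variable {W : WeierstrassCurve ℚ} [W.IsElliptic]

/-- **A CM curve `ℚ`-isogenous to a Shu–Zhai twist of `36a1` has CM field `ℚ(√−3)`** (`d_K = −3`):
the twist has `j = 0`, and the CM field is an isogeny invariant (`X12.cmFieldDiscrOfJ_eq_of_isIsogenous`).
[cite: SilvermanAEC2009, III.6 Cor. 6.2 and III.9 Cor. 9.4] -/
theorem cmFieldDiscrOfJ_eq_neg_three_of_isIsogenousToShuZhaiThirtySixTwist (hcm : W.HasCM)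
    (h : IsIsogenousToShuZhaiThirtySixTwist W) : cmFieldDiscrOfJ W.j = -3 := by
  obtain ⟨p, Q, hp, -, hQ, -, hiso⟩ := h
  have hm0 : p * ∏ q ∈ Q, q ≠ 0 :=
    Nat.pos_iff_ne_zero.mp (Nat.mul_pos hp.pos (Finset.prod_pos fun q hq => (hQ q hq).1.pos))
  have hd : (-((p * ∏ q ∈ Q, q : ℕ) : ℚ)) ≠ 0 := neg_ne_zero.mpr (by exact_mod_cast hm0)
  haveI := curve36a1.isElliptic_quadraticTwist hd
  rw [X12.cmFieldDiscrOfJ_eq_of_isIsogenous hiso hcm,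
    j_eq_zero_of_smul_twist_curve36a1 hd
      (show (1 : VariableChange ℚ) • curve36a1.quadraticTwist _ = _ from one_smul _ _)]
  simp [cmFieldDiscrOfJ]

/-- **A CM curve whose CM field is not `ℚ(√−3)` is `ℚ`-isogenous to NO Shu–Zhai twist of `36a1`.**
[cite: SilvermanAEC2009, III.6 Cor. 6.2 and III.9 Cor. 9.4] -/
theorem not_isIsogenousToShuZhaiThirtySixTwist_of_cmFieldDiscrOfJ_ne (hcm : W.HasCM)
    (h3 : cmFieldDiscrOfJ W.j ≠ -3) : ¬ IsIsogenousToShuZhaiThirtySixTwist W :=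
  fun h => h3 (cmFieldDiscrOfJ_eq_neg_three_of_isIsogenousToShuZhaiThirtySixTwist hcm h)

end OffShuZhai

/-- **`WAllCornerFTwoInertOffShuZhaiThirtySix` IN MODEL CURRENCY.** The residual of the p3 road is
EQUIVALENT to the conjunction of eight explicit family statements, each "`BSD(W, 2)` for every globally
minimal model `W` of analytic rank one of …": (1) `y² = x³ + B`, `B ∈ ℤ∖{0}`, NOT `ℚ`-isogenous to a
Shu–Zhai twist (the clause stays: the Shu–Zhai classes live here); (2) a square-free twist of
`⟨0,6,0,−3,0⟩` (`j = 54000`, p3's `curve36a1'`), NOT isogenous to a Shu–Zhai twist (clause stays: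
class `36a` has `j ∈ {0, 54000}`); (3) a square-free twist of `27a4 = ⟨0,0,1,−30,63⟩`
(`j = −12288000`), NOT isogenous to a Shu–Zhai twist (clause kept; `K = ℚ(√−3)`); (4)–(8) a square-free
twist of `cm11 = 121b1`, `cm19 = 361a1`, `cm43`, `cm67`, `cm163` — NO clause (CM field `≠ ℚ(√−3)`,
`not_isIsogenousToShuZhaiThirtySixTwist_of_cmFieldDiscrOfJ_ne`) and nothing in print at `2`. Fact-free.
[cite: SilvermanAEC2009, X.5 Prop. 5.4 and Cor. 5.4.1] [cite: Miller2011LMS, Def. 1.1 (arXiv:1010.2431 p. 3)] -/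
theorem wAllCornerFTwoInertOffShuZhaiThirtySix_iff_models :
    WAllCornerFTwoInertOffShuZhaiThirtySix ↔
      (∀ B : ℤ, B ≠ 0 →
        ∀ (W : WeierstrassCurve ℚ) [W.IsElliptic] [W.IsGloballyMinimal],
          (∃ C : VariableChange ℚ, C • (⟨0, 0, 0, 0, (B : ℚ)⟩ : WeierstrassCurve ℚ) = W) →
          ¬ IsIsogenousToShuZhaiThirtySixTwist W → W.analyticRank = 1 → BSDp W 2) ∧
      (∀ d : ℤ, d ≠ 0 → Squarefree d →
        ∀ (W : WeierstrassCurve ℚ) [W.IsElliptic] [W.IsGloballyMinimal],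
          (∃ C : VariableChange ℚ,
            C • (⟨0, 6, 0, -3, 0⟩ : WeierstrassCurve ℚ).quadraticTwist (d : ℚ) = W) →
          ¬ IsIsogenousToShuZhaiThirtySixTwist W → W.analyticRank = 1 → BSDp W 2) ∧
      (∀ d : ℤ, d ≠ 0 → Squarefree d →
        ∀ (W : WeierstrassCurve ℚ) [W.IsElliptic] [W.IsGloballyMinimal],
          (∃ C : VariableChange ℚ,
            C • (⟨0, 0, 1, -30, 63⟩ : WeierstrassCurve ℚ).quadraticTwist (d : ℚ) = W) →
          ¬ IsIsogenousToShuZhaiThirtySixTwist W → W.analyticRank = 1 → BSDp W 2) ∧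
      (∀ d : ℤ, d ≠ 0 → Squarefree d →
        ∀ (W : WeierstrassCurve ℚ) [W.IsElliptic] [W.IsGloballyMinimal],
          (∃ C : VariableChange ℚ, C • cm11.quadraticTwist (d : ℚ) = W) →
          W.analyticRank = 1 → BSDp W 2) ∧
      (∀ d : ℤ, d ≠ 0 → Squarefree d →
        ∀ (W : WeierstrassCurve ℚ) [W.IsElliptic] [W.IsGloballyMinimal],
          (∃ C : VariableChange ℚ, C • cm19.quadraticTwist (d : ℚ) = W) →
          W.analyticRank = 1 → BSDp W 2) ∧
      (∀ d : ℤ, d ≠ 0 → Squarefree d →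
        ∀ (W : WeierstrassCurve ℚ) [W.IsElliptic] [W.IsGloballyMinimal],
          (∃ C : VariableChange ℚ, C • cm43.quadraticTwist (d : ℚ) = W) →
          W.analyticRank = 1 → BSDp W 2) ∧
      (∀ d : ℤ, d ≠ 0 → Squarefree d →
        ∀ (W : WeierstrassCurve ℚ) [W.IsElliptic] [W.IsGloballyMinimal],
          (∃ C : VariableChange ℚ, C • cm67.quadraticTwist (d : ℚ) = W) →
          W.analyticRank = 1 → BSDp W 2) ∧
      (∀ d : ℤ, d ≠ 0 → Squarefree d →
        ∀ (W : WeierstrassCurve ℚ) [W.IsElliptic] [W.IsGloballyMinimal],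
          (∃ C : VariableChange ℚ, C • cm163.quadraticTwist (d : ℚ) = W) →
          W.analyticRank = 1 → BSDp W 2) := by
  haveI := isElliptic_curve27a4
  constructor
  · intro h
    -- the five odd fields: read `j` off the model; `d_K ≠ −3` kills the isogeny clause
    have twist : ∀ (E : WeierstrassCurve ℚ) [E.IsElliptic],
        (E.j = -32768 ∨ E.j = -884736 ∨ E.j = -884736000 ∨ E.j = -147197952000 ∨
          E.j = -262537412640768000) →
        ∀ d : ℤ, d ≠ 0 → Squarefree d →
          ∀ (W : WeierstrassCurve ℚ) [W.IsElliptic] [W.IsGloballyMinimal],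
            (∃ C : VariableChange ℚ, C • E.quadraticTwist (d : ℚ) = W) →
            W.analyticRank = 1 → BSDp W 2 := by
      intro E _ hjE d hd _ W _ _ hW hr
      obtain ⟨C, hC⟩ := hW
      have hd' : (d : ℚ) ≠ 0 := by exact_mod_cast hd
      have hjW : W.j = E.j := j_eq_of_smul_twist hd' hC
      obtain ⟨hcm, hin⟩ := hasCM_and_cmInert_two_of_j (W := W) (by rw [hjW]; tauto)
      have h3 : cmFieldDiscrOfJ W.j ≠ -3 := by
        rw [hjW]
        rcases hjE with hj | hj | hj | hj | hj <;> rw [hj] <;> norm_num [cmFieldDiscrOfJ]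
      exact h W hcm hr hin (not_isIsogenousToShuZhaiThirtySixTwist_of_cmFieldDiscrOfJ_ne hcm h3)
    refine ⟨?_, ?_, ?_, ?_, ?_, ?_, ?_, ?_⟩
    · intro B hB W _ _ hW hnot hr
      obtain ⟨C, hC⟩ := hW
      have hB' : (B : ℚ) ≠ 0 := by exact_mod_cast hB
      obtain ⟨hcm, hin⟩ := hasCM_and_cmInert_two_of_smul_sextic hB' hC
      exact h W hcm hr hin hnot
    · intro d hd _ W _ _ hW hnot hr
      obtain ⟨C, hC⟩ := hW
      have hd' : (d : ℚ) ≠ 0 := by exact_mod_cast hd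
      obtain ⟨hcm, hin⟩ := hasCM_and_cmInert_two_of_j (W := W)
        (Or.inl (by rw [j_eq_of_smul_twist hd' hC, j_cm12]))
      exact h W hcm hr hin hnot
    · intro d hd _ W _ _ hW hnot hr
      obtain ⟨C, hC⟩ := hW
      have hd' : (d : ℚ) ≠ 0 := by exact_mod_cast hd
      obtain ⟨hcm, hin⟩ := hasCM_and_cmInert_two_of_j (W := W)
        (Or.inr (Or.inl (by rw [j_eq_of_smul_twist hd' hC, j_curve27a4])))
      exact h W hcm hr hin hnot
    · exact twist _ (Or.inl j_cm11)
    · exact twist _ (Or.inr (Or.inl j_cm19))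
    · exact twist _ (Or.inr (Or.inr (Or.inl j_cm43)))
    · exact twist _ (Or.inr (Or.inr (Or.inr (Or.inl j_cm67))))
    · exact twist _ (Or.inr (Or.inr (Or.inr (Or.inr j_cm163))))
  · rintro ⟨h₁, h₂, h₃, h₄, h₅, h₆, h₇, h₈⟩ W _ _ hcm hr hin hnot
    rcases inertAtlas hcm hin with ⟨B, hB, hW⟩ | ⟨d, hd, hsq, hW⟩ | ⟨d, hd, hsq, hW⟩ |
        ⟨d, hd, hsq, hW⟩ | ⟨d, hd, hsq, hW⟩ | ⟨d, hd, hsq, hW⟩ | ⟨d, hd, hsq, hW⟩ | ⟨d, hd, hsq, hW⟩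
    · exact h₁ B hB W hW hnot hr
    · exact h₂ d hd hsq W hW hnot hr
    · exact h₃ d hd hsq W hW hnot hr
    · exact h₄ d hd hsq W hW hr
    · exact h₅ d hd hsq W hW hr
    · exact h₆ d hd hsq W hW hr
    · exact h₇ d hd hsq W hW hr
    · exact h₈ d hd hsq W hW hr

end Summit.BirchSwinnertonDyer.Rank1Residual.P2.CornerFTwo

end
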